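import Summits.BirchSwinnertonDyer.BirchSwinnertonDyer.Theorems.KolyvaginDepthDoorDepthTableRowKit
import Summits.BirchSwinnertonDyer.BirchSwinnertonDyer.Theorems.KolyvaginDepthDoorDepthTableGlobalMinimal
import Summits.BirchSwinnertonDyer.BirchSwinnertonDyer.Theorems.Rank2ObservatoryKernelCerts001
import Summits.BirchSwinnertonDyer.BirchSwinnertonDyer.Theorems.Rank2ObservatoryKernelCerts002
import Summits.BirchSwinnertonDyer.Rank1Residual.Additive.PointCountEulerNat
import Literature.NumberTheory.EllipticCurves.BurungaleSkinner2023.Curve14a1TwistsCertificate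
import HarnessLib

/-!
# Route `KolyvaginDepthDoor` — DEPTH-TABLE rows 3/6 (`655a1`, `664a1`, `681c1`) with CONCRETE admissible data
# `(p, d_K, ℓ)`, every side condition decided in the kernel (crux `KolyvaginDepthSupply`, stmt-BirchSwinnertonDyer-21765)

Helper file (`--supports stmt-BirchSwinnertonDyer-21765 --as helper`); it closes nothing. HONEST
FRAMING: per-curve certificate rows of the route's DEPTH TABLE (its cheapest falsifier / instrument,
"the 18 Cremona rank-2 curves `N ≤ 1000`"); each row is CONDITIONAL on exactly two inputs — Kolyvagin
1991 Thm. 4 (`hF`, the route's support item `KolyvaginStructure`, a named Literature fact) and the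
COMPUTED bit `c_1(ℓ) ≠ 0` (Jetchev–Lauter–Stein, arXiv:0707.0032 §3.6: `P_ℓ = Σ iσⁱ y_ℓ ∉ pE(K[ℓ])`,
degree `(ℓ+1) h_K` over `K`) — and BSD is not proved by it. What is NEW over the generic certificate
`depthRow_certificate_of_two_le_rank` (`KolyvaginDepthDoorDepthRow389a1`): the admissible data are
FIXED and ALL their side conditions are theorems of the kernel (kit `KolyvaginDepthDoorDepthTableRowKit`):
`ρ̄_{E,p}` onto (Mazur 6.3 Frobenius witness + Serre 1972 Prop. 21, semistable curves), `p` good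
ordinary, `N_E` (semistable curves), the Heegner hypothesis for `(N_E, d_K)`, `ℓ` a Kolyvagin prime
with `M(ℓ) ≥ 1`, `2 ≤ rank_ℤ E(ℚ)` (tree kernel certificates `Rank2Observatory.KernelCerts*`), global
minimality (`KolyvaginDepthDoorDepthTableGlobalMinimal`). So each row names the EXACT computation the
depth-table seat must run, and its outcome `c_1(ℓ) ≠ 0` certifies `corank_ℤ_p Ш(E)[p^∞] = 0` modulo
`hF` alone. Choice of data: `p` = least prime `≥ 5` of good ordinary reduction with `ρ̄` onto
(`5`, or `7` when `5 ∣ N`); `d_K` = the Heegner discriminant `∉ {−3, −4}`, `p ∤ d_K`, `|d_K| ≤ 120`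
minimising the JLS degree `(ℓ+1)·h_K` of its least Kolyvagin prime `ℓ`; `ℓ` = that prime.

| curve | `N` | `Δ` | `p` (`a_p`) | witness `q` (`a_q`) | `d_K` (`h_K`) | `ℓ` (`a_ℓ`) | `ρ̄` onto |
|---|---|---|---|---|---|---|---|
| `655a1` = `[0, 0, 1, -13, 18]` | `655` | `-3275` | `7` (`-3`) | `17` (`-2`) | `-51` (`2`) | `83` (`14`) | proved |
| `664a1` = `[0, 0, 0, -7, 10]` | `664` | `-21248` | `5` (`-4`) | `3` (`-3`) | `-39` (`4`) | `29` (`5`) | hypothesis (additive at 2) |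
| `681c1` = `[0, -1, 1, 0, 2]` | `681` | `-2043` | `5` (`-4`) | `13` (`-2`) | `-83` (`3`) | `19` (`-5`) | proved |

Per curve `C<label>`: `intModel`, `card_q` (kernel point counts), `hasSurjectiveModNGaloisRep_p` (or,
for the curves additive at `2`, only `hasIrreducibleModPGaloisRep_p` and `ρ̄` onto stays a hypothesis),
`goodOrdinary_p`, `conductorNorm_eq` (semistable curves), `heegner_negD`, and the row `depthRow_p_negD_ℓ`.

References: [Kolyvagin1991MathAnn] §2 Thm. 4; [WZhang2014] Thm. 11.2 (i), Notations (xii);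
[JetchevLauterStein2009] arXiv:0707.0032 §3.6, Prop. 3.10; [Serre1972] §5.4 Prop. 21; [Mazur1978]
§6 Prop. 6.3 (1); [CremonaAlgorithms1997] Table 1; [GrossLMS1991] §1, §3; [Marcus1977] Ch. 3 Thm. 25.
-/


set_option linter.dupNamespace false

noncomputable section

open scoped Classical NumberField

namespace Summit.BirchSwinnertonDyer.BirchSwinnertonDyer.Theorems.KolyvaginDepthDoor

open Literature.NumberTheory.EllipticCurves Literature.NumberTheory.EllipticCurves.ModularForms
  WeierstrassCurve
open Summit.BirchSwinnertonDyer.BirchSwinnertonDyer.Rank2Observatory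
open Summit.BirchSwinnertonDyer.BirchSwinnertonDyer.Rank1Residual
open Summit.BirchSwinnertonDyer.Rank1Residual.Additive


/-! ## Row `655a1` = `[0,0,1,-13,18]` (`N = 655`, `Δ = -3275`): `(p, d_K, ℓ) = (7, -51, 83)` -/

namespace C655a1

/-- The integral model of `655a1` is `[0, 0, 1, -13, 18]`. [cite: CremonaAlgorithms1997, Table 1 (655a1)] -/
theorem intModel :
    haveI := isGloballyMinimal_c655a1;
    integralModelInt ((⟨0, 0, 1, -13, 18⟩ : WeierstrassCurve ℤ).map (Int.castRingHom ℚ)) = ⟨0, 0, 1, -13, 18⟩ := by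
  haveI := isGloballyMinimal_c655a1
  exact IntModel.integralModelInt_eq_of_map_eq _ rfl

/-- `#Ẽ(𝔽_17) = 20`, `a_17 = -2` (irreducibility witness at `p = 7`) for `655a1`, kernel-decided (`ℕ`-arithmetic Euler
count `PointCountNat.natCard_point_map_eq`). [cite: CremonaAlgorithms1997, Table 1 (655a1)] -/
theorem card_17 :
    Nat.card (((⟨0, 0, 1, -13, 18⟩ : WeierstrassCurve ℤ).map (Int.castRingHom (ZMod 17))).toAffine.Point) = 20 := by
  rw [PointCountNat.natCard_point_map_eq (hℓ := ⟨by norm_num⟩) (by norm_num) 0 0 1 (-13) 18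
    (by decide +kernel)]
  decide +kernel

/-- `#Ẽ(𝔽_7) = 11`, `a_7 = -3` (`p` ordinary) for `655a1`, kernel-decided (`ℕ`-arithmetic Euler
count `PointCountNat.natCard_point_map_eq`). [cite: CremonaAlgorithms1997, Table 1 (655a1)] -/
theorem card_7 :
    Nat.card (((⟨0, 0, 1, -13, 18⟩ : WeierstrassCurve ℤ).map (Int.castRingHom (ZMod 7))).toAffine.Point) = 11 := by
  rw [PointCountNat.natCard_point_map_eq (hℓ := ⟨by norm_num⟩) (by norm_num) 0 0 1 (-13) 18
    (by decide +kernel)]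
  decide +kernel

/-- `#Ẽ(𝔽_83) = 70`, `a_83 = 14` (Kolyvagin prime: `7 ∣ 83 + 1`, `7 ∣ a_83`) for `655a1`, kernel-decided (`ℕ`-arithmetic Euler
count `PointCountNat.natCard_point_map_eq`). [cite: CremonaAlgorithms1997, Table 1 (655a1)] -/
theorem card_83 :
    Nat.card (((⟨0, 0, 1, -13, 18⟩ : WeierstrassCurve ℤ).map (Int.castRingHom (ZMod 83))).toAffine.Point) = 70 := by
  rw [PointCountNat.natCard_point_map_eq (hℓ := ⟨by norm_num⟩) (by norm_num) 0 0 1 (-13) 18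
    (by decide +kernel)]
  decide +kernel

/-- **`ρ̄_{E,7}` is surjective for `E = 655a1`** (unconditional): semistable (`gcd(c₄, Δ) = 1`) and
`X² − a_17X + 17` (`a_17 = -2`) has no root modulo `7` (Mazur's Frobenius certificate ⇒ `E[7]` irreducible;
Serre's Prop. 21 ⇒ onto). [cite: Serre1972, §5.4 Prop. 21] [cite: Mazur1978, §6 Prop. 6.3 (1)] -/
theorem hasSurjectiveModNGaloisRep_7 : ((⟨0, 0, 1, -13, 18⟩ : WeierstrassCurve ℤ).map (Int.castRingHom ℚ)).HasSurjectiveModNGaloisRep (7 : ℕ) := by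
  have hn : ∀ t : ZMod 7, t ^ 2 - (((17 : ℕ) : ℤ) + 1 - (20 : ℕ) : ℤ) * t + ((17 : ℕ) : ZMod 7) ≠ 0 := by
    decide +kernel
  haveI := Fact.mk (by norm_num : Nat.Prime 7)
  haveI := Fact.mk (by norm_num : Nat.Prime 17)
  haveI := isElliptic_c655a1
  haveI := isGloballyMinimal_c655a1
  exact hasSurjectiveModNGaloisRep_of_intModel_certificate intModel
    (by rw [Int.isCoprime_iff_gcd_eq_one]; decide +kernel) 7 17 (by norm_num) (by decide +kernel)
    (n := 20) card_17 hn

/-- **`7` is a prime of good ordinary reduction for `655a1`** (`7 ∤ Δ`, `a_7 = -3`). [cite: CremonaAlgorithms1997, Table 1 (655a1)] -/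
theorem goodOrdinary_7 :
    haveI := Fact.mk (by norm_num : Nat.Prime 7);
    haveI := isGloballyMinimal_c655a1;
    ((⟨0, 0, 1, -13, 18⟩ : WeierstrassCurve ℤ).map (Int.castRingHom ℚ)).HasGoodReductionAtPrime 7 ∧ ¬ ((7 : ℕ) : ℤ) ∣ ((⟨0, 0, 1, -13, 18⟩ : WeierstrassCurve ℤ).map (Int.castRingHom ℚ)).frobeniusTrace 7 := by
  haveI := Fact.mk (by norm_num : Nat.Prime 7)
  haveI := isGloballyMinimal_c655a1
  exact goodOrdinary_of_intModel_certificate intModel 7 (by decide +kernel) (n := 11) card_7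
    (by decide +kernel)

/-- **`N(655a1) = 655`** (semistable: `gcd(Δ, c₄) = 1`, `N = rad Δ`; Silverman ATAEC IV.10.2). [cite: CremonaAlgorithms1997, Table 1 (655a1)] -/
theorem conductorNorm_eq : ((⟨0, 0, 1, -13, 18⟩ : WeierstrassCurve ℤ).map (Int.castRingHom ℚ)).conductorNorm ℤ = 655 := by
  haveI := isElliptic_c655a1
  haveI := isGloballyMinimal_c655a1
  have h : ((⟨0, 0, 1, -13, 18⟩ : WeierstrassCurve ℤ).map (Int.castRingHom ℚ)) = (⟨0, 0, 1, -13, 18⟩ : WeierstrassCurve ℤ).baseChange ℚ :=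
    eq_baseChange_of_intModel intModel
  haveI : ((⟨0, 0, 1, -13, 18⟩ : WeierstrassCurve ℤ).baseChange ℚ).IsElliptic := by rw [← h]; infer_instance
  rw [h]
  refine BurungaleSkinner2023.conductorNorm_baseChange_int_of_isCoprime _
    (by rw [Int.isCoprime_iff_gcd_eq_one]; decide +kernel) (k := 2) ?_ (by decide +kernel)
    (by decide +kernel)
  rw [Nat.squarefree_iff_nodup_primeFactorsList (by norm_num)]; simp

/-- **Heegner data `d_K = -51` for `655a1`**: every prime of `Δ = -3275` (hence of `N_E`) splits in a quadratic
field of discriminant `-51` (Kronecker symbols `= 1`). [cite: Marcus1977, Ch. 3 Thm. 25] [cite: GrossLMS1991, §1] -/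
theorem heegner_neg51 : ∀ q : ℕ, q.Prime → (q : ℤ) ∣ (⟨0, 0, 1, -13, 18⟩ : WeierstrassCurve ℤ).Δ →
    (q = 2 → (-51 : ℤ) % 8 = 1) ∧ (q ≠ 2 → jacobiSym (-51) q = 1) :=
  forall_prime_dvd_of_natAbs_eq_pow_mul_pow (a := 5) (i := 2) (b := 131) (j := 1) (by decide +kernel)
    (by norm_num) (by norm_num) ⟨by norm_num, by norm_num⟩ ⟨by norm_num, by norm_num⟩

/-- **DEPTH-TABLE ROW `655a1`, `(p, d_K, ℓ) = (7, -51, 83)`, modulo Kolyvagin 1991 Thm. 4 (`hF`).** For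
`E = 655a1`, ANY imaginary quadratic `K` with `d_K = -51` (`h_K = 2`; such `K` exist, `exists_field_neg51`), any modular
parametrisation datum `Dt` of level `N_E`, `β`, `ι : K → ℂ`, and any Kolyvagin–Heegner datum `d` of conductor `83`
(a Kolyvagin prime: inert in `K`, `7 ∣ 84`, `7 ∣ a_83 = 14`): IF `c_1(83) ≠ 0` THEN `corank_ℤ7 Ш(E)[7^∞] = 0`,
`rank_ℤ E(ℚ) = 2`, `corank Sel_7∞(E/ℚ) = 2` and `corank Sel_7∞(E^(-51)/ℚ) = 1`. Every side condition is PROVED in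
the kernel; the inputs left are `hF` and the computed bit.
JLS cost `[K[83] : K] = 168`. BSD is not proved by it.
[cite: Kolyvagin1991MathAnn, §2 Thm. 4] [cite: JetchevLauterStein2009, §3.6 (arXiv:0707.0032)] -/
theorem depthRow_7_neg51_83 (hF : Kolyvagin1991_selmerCorank_of_kolyvaginClass_ne_zero)
    (K : Type) [Field K] [NumberField K] (hK : IsImaginaryQuadratic K)
    (hD : NumberField.discr K = -51) :
    haveI := isElliptic_c655a1;
    haveI := isGloballyMinimal_c655a1;
    haveI : NeZero (((⟨0, 0, 1, -13, 18⟩ : WeierstrassCurve ℤ).map (Int.castRingHom ℚ)).conductorNorm ℤ) := neZero_conductorNorm_of_isElliptic _;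
    ∀ (Dt : ModularParametrizationData ((⟨0, 0, 1, -13, 18⟩ : WeierstrassCurve ℤ).map (Int.castRingHom ℚ)) (((⟨0, 0, 1, -13, 18⟩ : WeierstrassCurve ℤ).map (Int.castRingHom ℚ)).conductorNorm ℤ)) (β : ℤ)
    (ι : K →+* ℂ) (d : KolyvaginHeegnerData Dt β ι 83),
    d.kolyvaginClass (p := 7) (by norm_num) 1 ≠ 0 →
    ((⟨0, 0, 1, -13, 18⟩ : WeierstrassCurve ℤ).map (Int.castRingHom ℚ)).shaCorank 7 = 0 ∧ ((⟨0, 0, 1, -13, 18⟩ : WeierstrassCurve ℤ).map (Int.castRingHom ℚ)).mordellWeilRank = 2 ∧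
      ((⟨0, 0, 1, -13, 18⟩ : WeierstrassCurve ℤ).map (Int.castRingHom ℚ)).selmerCorank 7 = 2 ∧
      (((⟨0, 0, 1, -13, 18⟩ : WeierstrassCurve ℤ).map (Int.castRingHom ℚ)).quadraticTwist ((-51 : ℤ) : ℚ)).selmerCorank 7 = 1 := by
  haveI := isElliptic_c655a1
  haveI := isGloballyMinimal_c655a1
  haveI : NeZero (((⟨0, 0, 1, -13, 18⟩ : WeierstrassCurve ℤ).map (Int.castRingHom ℚ)).conductorNorm ℤ) := neZero_conductorNorm_of_isElliptic _
  intro Dt β ι d hne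
  haveI := Fact.mk (by norm_num : Nat.Prime 7)
  exact depthRow_of_intModel_certificate intModel hF KernelCerts001.C655a1.two_le_rank 7 (by norm_num)
    (by decide +kernel) hasSurjectiveModNGaloisRep_7 K hK hD (by norm_num) (by norm_num) (by norm_num) heegner_neg51 83
    (by norm_num) (by norm_num) (by decide +kernel) (by norm_num) (by norm_num) (by norm_num) (by norm_num)
    (n := 70) card_83 (by norm_num) Dt β ι d hne

end C655a1

/-! ## Row `664a1` = `[0,0,0,-7,10]` (`N = 664`, `Δ = -21248`): `(p, d_K, ℓ) = (5, -39, 29)` -/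

namespace C664a1

/-- The integral model of `664a1` is `[0, 0, 0, -7, 10]`. [cite: CremonaAlgorithms1997, Table 1 (664a1)] -/
theorem intModel :
    haveI := isGloballyMinimal_c664a1;
    integralModelInt ((⟨0, 0, 0, -7, 10⟩ : WeierstrassCurve ℤ).map (Int.castRingHom ℚ)) = ⟨0, 0, 0, -7, 10⟩ := by
  haveI := isGloballyMinimal_c664a1
  exact IntModel.integralModelInt_eq_of_map_eq _ rfl

/-- `#Ẽ(𝔽_3) = 7`, `a_3 = -3` (irreducibility witness at `p = 5`) for `664a1`, kernel-decided (`ℕ`-arithmetic Euler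
count `PointCountNat.natCard_point_map_eq`). [cite: CremonaAlgorithms1997, Table 1 (664a1)] -/
theorem card_3 :
    Nat.card (((⟨0, 0, 0, -7, 10⟩ : WeierstrassCurve ℤ).map (Int.castRingHom (ZMod 3))).toAffine.Point) = 7 := by
  rw [PointCountNat.natCard_point_map_eq (hℓ := ⟨by norm_num⟩) (by norm_num) 0 0 0 (-7) 10
    (by decide +kernel)]
  decide +kernel

/-- `#Ẽ(𝔽_5) = 10`, `a_5 = -4` (`p` ordinary) for `664a1`, kernel-decided (`ℕ`-arithmetic Euler
count `PointCountNat.natCard_point_map_eq`). [cite: CremonaAlgorithms1997, Table 1 (664a1)] -/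
theorem card_5 :
    Nat.card (((⟨0, 0, 0, -7, 10⟩ : WeierstrassCurve ℤ).map (Int.castRingHom (ZMod 5))).toAffine.Point) = 10 := by
  rw [PointCountNat.natCard_point_map_eq (hℓ := ⟨by norm_num⟩) (by norm_num) 0 0 0 (-7) 10
    (by decide +kernel)]
  decide +kernel

/-- `#Ẽ(𝔽_29) = 25`, `a_29 = 5` (Kolyvagin prime: `5 ∣ 29 + 1`, `5 ∣ a_29`) for `664a1`, kernel-decided (`ℕ`-arithmetic Euler
count `PointCountNat.natCard_point_map_eq`). [cite: CremonaAlgorithms1997, Table 1 (664a1)] -/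
theorem card_29 :
    Nat.card (((⟨0, 0, 0, -7, 10⟩ : WeierstrassCurve ℤ).map (Int.castRingHom (ZMod 29))).toAffine.Point) = 25 := by
  rw [PointCountNat.natCard_point_map_eq (hℓ := ⟨by norm_num⟩) (by norm_num) 0 0 0 (-7) 10
    (by decide +kernel)]
  decide +kernel

/-- **`E[5]` is irreducible for `E = 664a1`** (unconditional): `X² − a_3X + 3` (`a_3 = -3`) has no root
modulo `5` (Mazur's Frobenius certificate). `664a1` is ADDITIVE at `2` (`gcd(c₄, Δ) ≠ 1`), so Serre's Prop. 21
does not give surjectivity here; the row below keeps `ρ̄ onto` as a hypothesis. [cite: Mazur1978, §6 Prop. 6.3 (1)] -/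
theorem hasIrreducibleModPGaloisRep_5 :
    haveI := Fact.mk (by norm_num : Nat.Prime 5); ((⟨0, 0, 0, -7, 10⟩ : WeierstrassCurve ℤ).map (Int.castRingHom ℚ)).HasIrreducibleModPGaloisRep 5 := by
  have hn : ∀ t : ZMod 5, t ^ 2 - (((3 : ℕ) : ℤ) + 1 - (7 : ℕ) : ℤ) * t + ((3 : ℕ) : ZMod 5) ≠ 0 := by
    decide +kernel
  haveI := Fact.mk (by norm_num : Nat.Prime 5)
  haveI := Fact.mk (by norm_num : Nat.Prime 3)
  haveI := isElliptic_c664a1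
  haveI := isGloballyMinimal_c664a1
  exact IntModel.hasIrreducibleModPGaloisRep_of_intModel_of_noroot intModel 5 3 (by norm_num)
    (by decide +kernel) (n := 7) card_3 hn

/-- **`5` is a prime of good ordinary reduction for `664a1`** (`5 ∤ Δ`, `a_5 = -4`). [cite: CremonaAlgorithms1997, Table 1 (664a1)] -/
theorem goodOrdinary_5 :
    haveI := Fact.mk (by norm_num : Nat.Prime 5);
    haveI := isGloballyMinimal_c664a1;
    ((⟨0, 0, 0, -7, 10⟩ : WeierstrassCurve ℤ).map (Int.castRingHom ℚ)).HasGoodReductionAtPrime 5 ∧ ¬ ((5 : ℕ) : ℤ) ∣ ((⟨0, 0, 0, -7, 10⟩ : WeierstrassCurve ℤ).map (Int.castRingHom ℚ)).frobeniusTrace 5 := by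
  haveI := Fact.mk (by norm_num : Nat.Prime 5)
  haveI := isGloballyMinimal_c664a1
  exact goodOrdinary_of_intModel_certificate intModel 5 (by decide +kernel) (n := 10) card_5
    (by decide +kernel)

/-- **Heegner data `d_K = -39` for `664a1`**: every prime of `Δ = -21248` (hence of `N_E`) splits in a quadratic
field of discriminant `-39` (Kronecker symbols `= 1`). [cite: Marcus1977, Ch. 3 Thm. 25] [cite: GrossLMS1991, §1] -/
theorem heegner_neg39 : ∀ q : ℕ, q.Prime → (q : ℤ) ∣ (⟨0, 0, 0, -7, 10⟩ : WeierstrassCurve ℤ).Δ →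
    (q = 2 → (-39 : ℤ) % 8 = 1) ∧ (q ≠ 2 → jacobiSym (-39) q = 1) :=
  forall_prime_dvd_of_natAbs_eq_pow_mul_pow (a := 2) (i := 8) (b := 83) (j := 1) (by decide +kernel)
    (by norm_num) (by norm_num) ⟨by norm_num, by norm_num⟩ ⟨by norm_num, by norm_num⟩

/-- **DEPTH-TABLE ROW `664a1`, `(p, d_K, ℓ) = (5, -39, 29)`, modulo Kolyvagin 1991 Thm. 4 (`hF`).** For
`E = 664a1`, ANY imaginary quadratic `K` with `d_K = -39` (`h_K = 4`; such `K` exist, `exists_field_neg39`), any modular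
parametrisation datum `Dt` of level `N_E`, `β`, `ι : K → ℂ`, and any Kolyvagin–Heegner datum `d` of conductor `29`
(a Kolyvagin prime: inert in `K`, `5 ∣ 30`, `5 ∣ a_29 = 5`): IF `c_1(29) ≠ 0` THEN `corank_ℤ5 Ш(E)[5^∞] = 0`,
`rank_ℤ E(ℚ) = 2`, `corank Sel_5∞(E/ℚ) = 2` and `corank Sel_5∞(E^(-39)/ℚ) = 1`. Every side condition is PROVED in
the kernel — EXCEPT `ρ̄ onto`, kept as the hypothesis `hsurj` (additive at `2`: Serre's Prop. 21 does not apply); the inputs left are `hF` and the computed bit.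
JLS cost `[K[29] : K] = 120`. BSD is not proved by it.
[cite: Kolyvagin1991MathAnn, §2 Thm. 4] [cite: JetchevLauterStein2009, §3.6 (arXiv:0707.0032)] -/
theorem depthRow_5_neg39_29 (hF : Kolyvagin1991_selmerCorank_of_kolyvaginClass_ne_zero)
    (hsurj : ((⟨0, 0, 0, -7, 10⟩ : WeierstrassCurve ℤ).map (Int.castRingHom ℚ)).HasSurjectiveModNGaloisRep (5 : ℕ))
    (K : Type) [Field K] [NumberField K] (hK : IsImaginaryQuadratic K)
    (hD : NumberField.discr K = -39) :
    haveI := isElliptic_c664a1;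
    haveI := isGloballyMinimal_c664a1;
    haveI : NeZero (((⟨0, 0, 0, -7, 10⟩ : WeierstrassCurve ℤ).map (Int.castRingHom ℚ)).conductorNorm ℤ) := neZero_conductorNorm_of_isElliptic _;
    ∀ (Dt : ModularParametrizationData ((⟨0, 0, 0, -7, 10⟩ : WeierstrassCurve ℤ).map (Int.castRingHom ℚ)) (((⟨0, 0, 0, -7, 10⟩ : WeierstrassCurve ℤ).map (Int.castRingHom ℚ)).conductorNorm ℤ)) (β : ℤ)
    (ι : K →+* ℂ) (d : KolyvaginHeegnerData Dt β ι 29),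
    d.kolyvaginClass (p := 5) (by norm_num) 1 ≠ 0 →
    ((⟨0, 0, 0, -7, 10⟩ : WeierstrassCurve ℤ).map (Int.castRingHom ℚ)).shaCorank 5 = 0 ∧ ((⟨0, 0, 0, -7, 10⟩ : WeierstrassCurve ℤ).map (Int.castRingHom ℚ)).mordellWeilRank = 2 ∧
      ((⟨0, 0, 0, -7, 10⟩ : WeierstrassCurve ℤ).map (Int.castRingHom ℚ)).selmerCorank 5 = 2 ∧
      (((⟨0, 0, 0, -7, 10⟩ : WeierstrassCurve ℤ).map (Int.castRingHom ℚ)).quadraticTwist ((-39 : ℤ) : ℚ)).selmerCorank 5 = 1 := by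
  haveI := isElliptic_c664a1
  haveI := isGloballyMinimal_c664a1
  haveI : NeZero (((⟨0, 0, 0, -7, 10⟩ : WeierstrassCurve ℤ).map (Int.castRingHom ℚ)).conductorNorm ℤ) := neZero_conductorNorm_of_isElliptic _
  intro Dt β ι d hne
  haveI := Fact.mk (by norm_num : Nat.Prime 5)
  exact depthRow_of_intModel_certificate intModel hF KernelCerts001.C664a1.two_le_rank 5 (by norm_num)
    (by decide +kernel) hsurj K hK hD (by norm_num) (by norm_num) (by norm_num) heegner_neg39 29
    (by norm_num) (by norm_num) (by decide +kernel) (by norm_num) (by norm_num) (by norm_num) (by norm_num)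
    (n := 25) card_29 (by norm_num) Dt β ι d hne

end C664a1

/-! ## Row `681c1` = `[0,-1,1,0,2]` (`N = 681`, `Δ = -2043`): `(p, d_K, ℓ) = (5, -83, 19)` -/

namespace C681c1

/-- The integral model of `681c1` is `[0, -1, 1, 0, 2]`. [cite: CremonaAlgorithms1997, Table 1 (681c1)] -/
theorem intModel :
    haveI := isGloballyMinimal_c681c1;
    integralModelInt ((⟨0, -1, 1, 0, 2⟩ : WeierstrassCurve ℤ).map (Int.castRingHom ℚ)) = ⟨0, -1, 1, 0, 2⟩ := by
  haveI := isGloballyMinimal_c681c1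
  exact IntModel.integralModelInt_eq_of_map_eq _ rfl

/-- `#Ẽ(𝔽_13) = 16`, `a_13 = -2` (irreducibility witness at `p = 5`) for `681c1`, kernel-decided (`ℕ`-arithmetic Euler
count `PointCountNat.natCard_point_map_eq`). [cite: CremonaAlgorithms1997, Table 1 (681c1)] -/
theorem card_13 :
    Nat.card (((⟨0, -1, 1, 0, 2⟩ : WeierstrassCurve ℤ).map (Int.castRingHom (ZMod 13))).toAffine.Point) = 16 := by
  rw [PointCountNat.natCard_point_map_eq (hℓ := ⟨by norm_num⟩) (by norm_num) 0 (-1) 1 0 2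
    (by decide +kernel)]
  decide +kernel

/-- `#Ẽ(𝔽_5) = 10`, `a_5 = -4` (`p` ordinary) for `681c1`, kernel-decided (`ℕ`-arithmetic Euler
count `PointCountNat.natCard_point_map_eq`). [cite: CremonaAlgorithms1997, Table 1 (681c1)] -/
theorem card_5 :
    Nat.card (((⟨0, -1, 1, 0, 2⟩ : WeierstrassCurve ℤ).map (Int.castRingHom (ZMod 5))).toAffine.Point) = 10 := by
  rw [PointCountNat.natCard_point_map_eq (hℓ := ⟨by norm_num⟩) (by norm_num) 0 (-1) 1 0 2
    (by decide +kernel)]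
  decide +kernel

/-- `#Ẽ(𝔽_19) = 25`, `a_19 = -5` (Kolyvagin prime: `5 ∣ 19 + 1`, `5 ∣ a_19`) for `681c1`, kernel-decided (`ℕ`-arithmetic Euler
count `PointCountNat.natCard_point_map_eq`). [cite: CremonaAlgorithms1997, Table 1 (681c1)] -/
theorem card_19 :
    Nat.card (((⟨0, -1, 1, 0, 2⟩ : WeierstrassCurve ℤ).map (Int.castRingHom (ZMod 19))).toAffine.Point) = 25 := by
  rw [PointCountNat.natCard_point_map_eq (hℓ := ⟨by norm_num⟩) (by norm_num) 0 (-1) 1 0 2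
    (by decide +kernel)]
  decide +kernel

/-- **`ρ̄_{E,5}` is surjective for `E = 681c1`** (unconditional): semistable (`gcd(c₄, Δ) = 1`) and
`X² − a_13X + 13` (`a_13 = -2`) has no root modulo `5` (Mazur's Frobenius certificate ⇒ `E[5]` irreducible;
Serre's Prop. 21 ⇒ onto). [cite: Serre1972, §5.4 Prop. 21] [cite: Mazur1978, §6 Prop. 6.3 (1)] -/
theorem hasSurjectiveModNGaloisRep_5 : ((⟨0, -1, 1, 0, 2⟩ : WeierstrassCurve ℤ).map (Int.castRingHom ℚ)).HasSurjectiveModNGaloisRep (5 : ℕ) := by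
  have hn : ∀ t : ZMod 5, t ^ 2 - (((13 : ℕ) : ℤ) + 1 - (16 : ℕ) : ℤ) * t + ((13 : ℕ) : ZMod 5) ≠ 0 := by
    decide +kernel
  haveI := Fact.mk (by norm_num : Nat.Prime 5)
  haveI := Fact.mk (by norm_num : Nat.Prime 13)
  haveI := isElliptic_c681c1
  haveI := isGloballyMinimal_c681c1
  exact hasSurjectiveModNGaloisRep_of_intModel_certificate intModel
    (by rw [Int.isCoprime_iff_gcd_eq_one]; decide +kernel) 5 13 (by norm_num) (by decide +kernel)
    (n := 16) card_13 hn

/-- **`5` is a prime of good ordinary reduction for `681c1`** (`5 ∤ Δ`, `a_5 = -4`). [cite: CremonaAlgorithms1997, Table 1 (681c1)] -/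
theorem goodOrdinary_5 :
    haveI := Fact.mk (by norm_num : Nat.Prime 5);
    haveI := isGloballyMinimal_c681c1;
    ((⟨0, -1, 1, 0, 2⟩ : WeierstrassCurve ℤ).map (Int.castRingHom ℚ)).HasGoodReductionAtPrime 5 ∧ ¬ ((5 : ℕ) : ℤ) ∣ ((⟨0, -1, 1, 0, 2⟩ : WeierstrassCurve ℤ).map (Int.castRingHom ℚ)).frobeniusTrace 5 := by
  haveI := Fact.mk (by norm_num : Nat.Prime 5)
  haveI := isGloballyMinimal_c681c1
  exact goodOrdinary_of_intModel_certificate intModel 5 (by decide +kernel) (n := 10) card_5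
    (by decide +kernel)

/-- **`N(681c1) = 681`** (semistable: `gcd(Δ, c₄) = 1`, `N = rad Δ`; Silverman ATAEC IV.10.2). [cite: CremonaAlgorithms1997, Table 1 (681c1)] -/
theorem conductorNorm_eq : ((⟨0, -1, 1, 0, 2⟩ : WeierstrassCurve ℤ).map (Int.castRingHom ℚ)).conductorNorm ℤ = 681 := by
  haveI := isElliptic_c681c1
  haveI := isGloballyMinimal_c681c1
  have h : ((⟨0, -1, 1, 0, 2⟩ : WeierstrassCurve ℤ).map (Int.castRingHom ℚ)) = (⟨0, -1, 1, 0, 2⟩ : WeierstrassCurve ℤ).baseChange ℚ :=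
    eq_baseChange_of_intModel intModel
  haveI : ((⟨0, -1, 1, 0, 2⟩ : WeierstrassCurve ℤ).baseChange ℚ).IsElliptic := by rw [← h]; infer_instance
  rw [h]
  refine BurungaleSkinner2023.conductorNorm_baseChange_int_of_isCoprime _
    (by rw [Int.isCoprime_iff_gcd_eq_one]; decide +kernel) (k := 2) ?_ (by decide +kernel)
    (by decide +kernel)
  rw [Nat.squarefree_iff_nodup_primeFactorsList (by norm_num)]; simp

/-- **Heegner data `d_K = -83` for `681c1`**: every prime of `Δ = -2043` (hence of `N_E`) splits in a quadratic
field of discriminant `-83` (Kronecker symbols `= 1`). [cite: Marcus1977, Ch. 3 Thm. 25] [cite: GrossLMS1991, §1] -/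
theorem heegner_neg83 : ∀ q : ℕ, q.Prime → (q : ℤ) ∣ (⟨0, -1, 1, 0, 2⟩ : WeierstrassCurve ℤ).Δ →
    (q = 2 → (-83 : ℤ) % 8 = 1) ∧ (q ≠ 2 → jacobiSym (-83) q = 1) :=
  forall_prime_dvd_of_natAbs_eq_pow_mul_pow (a := 3) (i := 2) (b := 227) (j := 1) (by decide +kernel)
    (by norm_num) (by norm_num) ⟨by norm_num, by norm_num⟩ ⟨by norm_num, by norm_num⟩

/-- **DEPTH-TABLE ROW `681c1`, `(p, d_K, ℓ) = (5, -83, 19)`, modulo Kolyvagin 1991 Thm. 4 (`hF`).** For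
`E = 681c1`, ANY imaginary quadratic `K` with `d_K = -83` (`h_K = 3`; such `K` exist, `exists_field_neg83`), any modular
parametrisation datum `Dt` of level `N_E`, `β`, `ι : K → ℂ`, and any Kolyvagin–Heegner datum `d` of conductor `19`
(a Kolyvagin prime: inert in `K`, `5 ∣ 20`, `5 ∣ a_19 = -5`): IF `c_1(19) ≠ 0` THEN `corank_ℤ5 Ш(E)[5^∞] = 0`,
`rank_ℤ E(ℚ) = 2`, `corank Sel_5∞(E/ℚ) = 2` and `corank Sel_5∞(E^(-83)/ℚ) = 1`. Every side condition is PROVED in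
the kernel; the inputs left are `hF` and the computed bit.
JLS cost `[K[19] : K] = 60`. BSD is not proved by it.
[cite: Kolyvagin1991MathAnn, §2 Thm. 4] [cite: JetchevLauterStein2009, §3.6 (arXiv:0707.0032)] -/
theorem depthRow_5_neg83_19 (hF : Kolyvagin1991_selmerCorank_of_kolyvaginClass_ne_zero)
    (K : Type) [Field K] [NumberField K] (hK : IsImaginaryQuadratic K)
    (hD : NumberField.discr K = -83) :
    haveI := isElliptic_c681c1;
    haveI := isGloballyMinimal_c681c1;
    haveI : NeZero (((⟨0, -1, 1, 0, 2⟩ : WeierstrassCurve ℤ).map (Int.castRingHom ℚ)).conductorNorm ℤ) := neZero_conductorNorm_of_isElliptic _;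
    ∀ (Dt : ModularParametrizationData ((⟨0, -1, 1, 0, 2⟩ : WeierstrassCurve ℤ).map (Int.castRingHom ℚ)) (((⟨0, -1, 1, 0, 2⟩ : WeierstrassCurve ℤ).map (Int.castRingHom ℚ)).conductorNorm ℤ)) (β : ℤ)
    (ι : K →+* ℂ) (d : KolyvaginHeegnerData Dt β ι 19),
    d.kolyvaginClass (p := 5) (by norm_num) 1 ≠ 0 →
    ((⟨0, -1, 1, 0, 2⟩ : WeierstrassCurve ℤ).map (Int.castRingHom ℚ)).shaCorank 5 = 0 ∧ ((⟨0, -1, 1, 0, 2⟩ : WeierstrassCurve ℤ).map (Int.castRingHom ℚ)).mordellWeilRank = 2 ∧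
      ((⟨0, -1, 1, 0, 2⟩ : WeierstrassCurve ℤ).map (Int.castRingHom ℚ)).selmerCorank 5 = 2 ∧
      (((⟨0, -1, 1, 0, 2⟩ : WeierstrassCurve ℤ).map (Int.castRingHom ℚ)).quadraticTwist ((-83 : ℤ) : ℚ)).selmerCorank 5 = 1 := by
  haveI := isElliptic_c681c1
  haveI := isGloballyMinimal_c681c1
  haveI : NeZero (((⟨0, -1, 1, 0, 2⟩ : WeierstrassCurve ℤ).map (Int.castRingHom ℚ)).conductorNorm ℤ) := neZero_conductorNorm_of_isElliptic _
  intro Dt β ι d hne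
  haveI := Fact.mk (by norm_num : Nat.Prime 5)
  exact depthRow_of_intModel_certificate intModel hF KernelCerts002.C681c1.two_le_rank 5 (by norm_num)
    (by decide +kernel) hasSurjectiveModNGaloisRep_5 K hK hD (by norm_num) (by norm_num) (by norm_num) heegner_neg83 19
    (by norm_num) (by norm_num) (by decide +kernel) (by norm_num) (by norm_num) (by norm_num) (by norm_num)
    (n := 25) card_19 (by norm_num) Dt β ι d hne

end C681c1

end Summit.BirchSwinnertonDyer.BirchSwinnertonDyer.Theorems.KolyvaginDepthDoor

end
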